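import Mathlib
import HarnessLib
import Summits.HubbardSuperconductivity.HubbardSuperconductivity.Theorems.KLProgrammeKLRegimeEngineTwoLegStepV17F2ClosersGrid
import Summits.HubbardSuperconductivity.HubbardSuperconductivity.Theorems.KLProgrammeKLRegimeEngineV8DefsU9
import Summits.HubbardSuperconductivity.HubbardSuperconductivity.Theorems.KLProgrammeKLRegimeEngineV8DefsQ7

/-!
# K3 gen 8, ENGINE child `KLRegimeEngineV17F2` (stmt-HubbardSuperconductivity-20437), stubs (e)/(M): the closer shells AT THE REGISTERED BYTES
# `(G, Q, c₃, U₀) = (klEngGeo7, klEngQ7 P R, klEngC₃6 P R, klEngU₀9 P R c)` (frozen token set {V17F2 ×6, #7, #8, #10, #12}, plan g17 (R44))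

Cell gate-hubbard-kl, seat hubbard-kl-r2d-p1 (g6).  The (G, Q)+threshold-parametric shells of `…EngineTwoLegStepV17F2ClosersGQ` (p534923) instantiated
ONCE at the registered package, so that the (e)/(M) provers of the registered skeleton call ONE name with the stub's literal binder list and nothing to
thread:

* §1 the two package rows at `klEngQ7`: `klC4aJetC'_le_klEngQ7_S'` (c4a-1's `klC4aJetC'_le_klEngQ6_S'` through the `rfl` row `klEngQ7_S'` of
  `…EngineV8DefsQ7` — `raiseCEOnly` does not touch `S'`) and `klEngQ7_CL_nonneg` (through `klEngQ7_CL`);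
* §2 **`stub_twoLeg_step_of_residuals_Q7U9`** — stub (e)'s LITERAL binders + rows B1 `hz` · B2 `hm₁'` · B3 `hfit1` · C1 `hcut` · C2 `hsp`
  ⇒ `TwoLegStepV17F2 L M klEngGeo7 P (klEngQ7 P R) R β U μ n`;
  **`stub_twoLeg_step_of_engineSizes_Q7U9`** — the same with rows B1′ `hzZ` · B2′ `hmS` (SIZES `Z·U²`, `S·U²`, `Z, S ≤ 2^{10|11}e¹⁸κ₀⁴·klE3Acum R`;
  the fits are discharged by the all-scales door `klEngU₀9 ≤ klE3U₀all`);
  **`stub_twoLeg_scale0_of_twoLegStepV17F_zero_Q7U9`** — stub (M)'s LITERAL binders + the rev-1 text `TwoLegStepV17F … (klEngQ7 P R) … 0` ⇒ the rev-2 text;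
* §3 **`stub_twoLeg_step_of_gridMoments_Q7U9`** — stub (e)'s LITERAL binders + residual B in GRID-MOMENT currency (two pinned weighted sums of
  `kernel₂ (W_n[K_n] − 𝒩_{K_n,4M})`, `…ClosersGrid`) + C1/C2 ⇒ `TwoLegStepV17F2 L M klEngGeo7 P (klEngQ7 P R) R β U μ n`.

So, on the registered bytes, stub (e)'s open content is exactly {A1 = stub (C)'s `TwoLegReadJetBound … (K_n) n` (a HYPOTHESIS of (e)); B = the two
one-shot-tower SIZES at `(K_n, n)`; C1/C2 = the two two-volume legs} (HOME/hubbard-kl-r2d-p1/RESIDUAL-TABLE-e-V17F.md v4).  Proofs only; no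
definitions; nothing about the model is asserted; nothing asserts superconductivity.  [cite: BenfattoGiulianiMastropietro2006] (§2.4 (2.36)).
-/

noncomputable section

namespace Summit.HubbardSuperconductivity.HubbardSuperconductivity.Theorems.EngineV8

set_option linter.dupNamespace false -- summit = problem name (single-conjunct summit), D-0017

open Real Finset Literature.MathematicalPhysics.QuantumLattice Literature.Probability.LatticeModels
open Literature.MathematicalPhysics.QuantumLattice.FermiRG Literature.MathematicalPhysics.QuantumLattice.BandSectorCounting
open Summit.HubbardSuperconductivity.HubbardSuperconductivity.Theorems.KLProgrammeLegKernels
open Summit.HubbardSuperconductivity.HubbardSuperconductivity.Theorems.DispersionFlow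
open Summit.HubbardSuperconductivity.HubbardSuperconductivity.Theorems.PerturbedFermiCurve
open Summit.HubbardSuperconductivity.HubbardSuperconductivity.Theorems.KLRegimeSplit
open Summit.HubbardSuperconductivity.HubbardSuperconductivity.Theorems.TwoPointAssembly GrassmannAlgebra

/-! ## §1 The package rows at `klEngQ7` -/

/-- **Row A2 at the v7 package**: `klC4aJetC' P R k ≤ (klEngQ7 P R).S' k` (`(klEngQ7 P R).S' = (klEngQ6 P R).S'`, `rfl`). -/
theorem klC4aJetC'_le_klEngQ7_S' (P : SplitConsts) (R : RenConsts) (k : ℕ) : klC4aJetC' P R k ≤ (klEngQ7 P R).S' k := by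
  rw [klEngQ7_S']
  exact klC4aJetC'_le_klEngQ6_S' P R k

/-- **Row S at the v7 package**: `0 ≤ (klEngQ7 P R).CL β n` (`(klEngQ7 P R).CL = (klEngQ6 P R).CL`, `rfl`). -/
theorem klEngQ7_CL_nonneg (P : SplitConsts) (R : RenConsts) (β : ℝ) (n : ℕ) : 0 ≤ (klEngQ7 P R).CL β n := by
  rw [klEngQ7_CL]
  exact klEngQ6_CL_nonneg P R β n

/-! ## §2 The shells at the registered bytes -/

/-- **STUB (e) OF 20437 MODULO ITS NAMED RESIDUALS, AT THE REGISTERED BYTES** `(klEngGeo7, klEngQ7 P R, klEngC₃6 P R, klEngU₀9 P R c)`: the stub's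
literal binders, then rows B1 `hz`, B2 `hm₁'`, B3 `hfit1`, C1 `hcut`, C2 `hsp` ⇒ `TwoLegStepV17F2 L M klEngGeo7 P (klEngQ7 P R) R β U μ n`. -/
theorem stub_twoLeg_step_of_residuals_Q7U9 (P : SplitConsts) (R : RenConsts) (c : ℝ) (hP : P.WF) (hR : R.WF2) (hc : 0 < c)
    (hc3 : c ≤ klEngC₃6 P R) (μ : ℝ) (hμ : μ ∈ klWindowC) (U : ℝ) (hU : 0 < U) (hUle : U ≤ klEngU₀9 P R c) (β : ℝ)
    (hβ : klBetaMin ≤ β) (hβc : β ≤ Real.exp (c / U ^ 2)) (L M : ℕ) [NeZero L] [NeZero M] (hL : klEngL₃ β U ≤ L)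
    (hM : klEngM₃ β U L ≤ M) (n : ℕ) (hn1 : 1 ≤ n) (hn : n ≤ nScales β + 1) (hreg : IsKLRegime U c (-(n : ℤ)))
    (hhist : HistP klPredsV17F2 L M klEngGeo7 P (klEngQ7 P R) R β U μ 0 n)
    (hfr : FrameOK R U (nScales β) μ (klFlowFrameU L M β U μ n))
    (hE : EngineBoundsAtV17F2 L M klEngGeo7 P (klEngQ7 P R) β U μ n)
    (hJ : TwoLegReadJetBound L M klC4aJetC (klC4aJetC' P R) β U μ (klFlowFrameU L M β U μ n) n)
    (hz : ∀ k ∈ klShell L μ (klFlowFrameU L M β U μ n) n, |klFieldStrength L M β U μ (klFlowFrameU L M β U μ n) n k - 1| ≤ R.cz * |U|)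
    {m₁' : ℝ}
    (hm₁' : ∀ q : Momentum, |frameLevel μ (klFlowFrameU L M β U μ n) q| ≤ klScale klE0 n →
      ‖fderiv ℝ (evalM (symInterp L (fun p => klLocSelfEnergyRe L M β U μ (klFlowFrameU L M β U μ n) n p -
        (klFlowFrameU L M β U μ n).eval (latticeMomentum L p)))) q‖ ≤ m₁')
    (hfit1 : m₁' + 4 / 3 * R.Gfr 1 * U ^ 2 ≤ R.cz * |U| * (cDtmin (-1.2) (-0.05) / 2))
    (hcut : ∀ (Mq : ℕ → ℕ) (L₁ M₁ M₂ : ℕ) [NeZero L₁] [NeZero M₁] [NeZero M₂], L ≤ L₁ → (klEngQ7 P R).M0 β L₁ ≤ M₁ → Mq L₁ ≤ M₁ →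
      M₁ ≤ M₂ →
      (∀ j < n, histV17F2 L₁ M₁ klEngGeo7 P (klEngQ7 P R) R β U μ j ∧ TwoLegSlopes L₁ M₁ R β U μ (klFlowFrameU L₁ M₁ β U μ j) j) →
      (∀ j < n, histV17F2 L₁ M₂ klEngGeo7 P (klEngQ7 P R) R β U μ j ∧ TwoLegSlopes L₁ M₂ R β U μ (klFlowFrameU L₁ M₂ β U μ j) j) →
        ∀ θ : ℝ, |klLocalPart L₁ M₁ β U μ (klFlowFrameU L₁ M₁ β U μ n) n θ -
          klLocalPart L₁ M₂ β U μ (klFlowFrameU L₁ M₂ β U μ n) n θ| ≤ (klEngQ7 P R).CL β n / 4 / L₁)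
    (hsp : ∀ (Mq : ℕ → ℕ) (L₁ L₂ M₂ : ℕ) [NeZero L₁] [NeZero L₂] [NeZero M₂], L ≤ L₁ → L₁ ∣ L₂ → (klEngQ7 P R).M0 β L₁ ≤ M₂ →
      Mq L₁ ≤ M₂ → (klEngQ7 P R).M0 β L₂ ≤ M₂ → Mq L₂ ≤ M₂ →
      (∀ j < n, histV17F2 L₁ M₂ klEngGeo7 P (klEngQ7 P R) R β U μ j ∧ TwoLegSlopes L₁ M₂ R β U μ (klFlowFrameU L₁ M₂ β U μ j) j) →
      (∀ j < n, histV17F2 L₂ M₂ klEngGeo7 P (klEngQ7 P R) R β U μ j ∧ TwoLegSlopes L₂ M₂ R β U μ (klFlowFrameU L₂ M₂ β U μ j) j) →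
        ∀ θ : ℝ, |klLocalPart L₁ M₂ β U μ (klFlowFrameU L₁ M₂ β U μ n) n θ -
          klLocalPart L₂ M₂ β U μ (klFlowFrameU L₂ M₂ β U μ n) n θ| ≤ (klEngQ7 P R).CL β n / 4 / L₁) :
    TwoLegStepV17F2 L M klEngGeo7 P (klEngQ7 P R) R β U μ n :=
  stub_twoLeg_step_of_residuals_GQ klEngGeo7 (klEngQ7 P R) P R c klC4aJetC_le_klEngGeo7_S (klC4aJetC'_le_klEngQ7_S' P R)
    (klEngQ7_CL_nonneg P R) (klEngC₃6_le_klEngC₃3 P R) (klEngU₀9_le_klEngU₀4 P R c) hP hR hc hc3 μ hμ U hU hUle β hβ hβc L M hL hM n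
    hn1 hn hreg hhist hfr hE hJ hz hm₁' hfit1 hcut hsp

/-- **STUB (e) OF 20437 MODULO ENGINE SIZES, AT THE REGISTERED BYTES**: the stub's literal binders, then rows B1′ `hzZ`, B2′ `hmS` (SIZES with
`Z ≤ 2^10·e¹⁸κ₀⁴·klE3Acum R`, `S ≤ 2^11·e¹⁸κ₀⁴·klE3Acum R`, `κ₀² = 2(7+1606732)`), C1 `hcut`, C2 `hsp` ⇒ `TwoLegStepV17F2 L M klEngGeo7 P (klEngQ7 P R) R β U μ n`
(the (E3d)/(E3e) FITS are discharged by `klEngU₀9 P R c ≤ klE3U₀all R`). -/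
theorem stub_twoLeg_step_of_engineSizes_Q7U9 (P : SplitConsts) (R : RenConsts) (c : ℝ) (hP : P.WF) (hR : R.WF2) (hc : 0 < c)
    (hc3 : c ≤ klEngC₃6 P R) (μ : ℝ) (hμ : μ ∈ klWindowC) (U : ℝ) (hU : 0 < U) (hUle : U ≤ klEngU₀9 P R c) (β : ℝ)
    (hβ : klBetaMin ≤ β) (hβc : β ≤ Real.exp (c / U ^ 2)) (L M : ℕ) [NeZero L] [NeZero M] (hL : klEngL₃ β U ≤ L)
    (hM : klEngM₃ β U L ≤ M) (n : ℕ) (hn1 : 1 ≤ n) (hn : n ≤ nScales β + 1) (hreg : IsKLRegime U c (-(n : ℤ)))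
    (hhist : HistP klPredsV17F2 L M klEngGeo7 P (klEngQ7 P R) R β U μ 0 n)
    (hfr : FrameOK R U (nScales β) μ (klFlowFrameU L M β U μ n))
    (hE : EngineBoundsAtV17F2 L M klEngGeo7 P (klEngQ7 P R) β U μ n)
    (hJ : TwoLegReadJetBound L M klC4aJetC (klC4aJetC' P R) β U μ (klFlowFrameU L M β U μ n) n)
    {Z S : ℝ} (hZ : Z ≤ (2 : ℝ) ^ 10 * Real.exp 1 ^ 18 * Real.sqrt (2 * (7 + 1606732)) ^ 4 * klE3Acum R)
    (hS : S ≤ (2 : ℝ) ^ 11 * Real.exp 1 ^ 18 * Real.sqrt (2 * (7 + 1606732)) ^ 4 * klE3Acum R)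
    (hzZ : ∀ k ∈ klShell L μ (klFlowFrameU L M β U μ n) n, |klFieldStrength L M β U μ (klFlowFrameU L M β U μ n) n k - 1| ≤ Z * U ^ 2)
    (hmS : ∀ q : Momentum, |frameLevel μ (klFlowFrameU L M β U μ n) q| ≤ klScale klE0 n →
      ‖fderiv ℝ (evalM (symInterp L (fun p => klLocSelfEnergyRe L M β U μ (klFlowFrameU L M β U μ n) n p -
        (klFlowFrameU L M β U μ n).eval (latticeMomentum L p)))) q‖ ≤ S * U ^ 2)
    (hcut : ∀ (Mq : ℕ → ℕ) (L₁ M₁ M₂ : ℕ) [NeZero L₁] [NeZero M₁] [NeZero M₂], L ≤ L₁ → (klEngQ7 P R).M0 β L₁ ≤ M₁ → Mq L₁ ≤ M₁ →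
      M₁ ≤ M₂ →
      (∀ j < n, histV17F2 L₁ M₁ klEngGeo7 P (klEngQ7 P R) R β U μ j ∧ TwoLegSlopes L₁ M₁ R β U μ (klFlowFrameU L₁ M₁ β U μ j) j) →
      (∀ j < n, histV17F2 L₁ M₂ klEngGeo7 P (klEngQ7 P R) R β U μ j ∧ TwoLegSlopes L₁ M₂ R β U μ (klFlowFrameU L₁ M₂ β U μ j) j) →
        ∀ θ : ℝ, |klLocalPart L₁ M₁ β U μ (klFlowFrameU L₁ M₁ β U μ n) n θ -
          klLocalPart L₁ M₂ β U μ (klFlowFrameU L₁ M₂ β U μ n) n θ| ≤ (klEngQ7 P R).CL β n / 4 / L₁)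
    (hsp : ∀ (Mq : ℕ → ℕ) (L₁ L₂ M₂ : ℕ) [NeZero L₁] [NeZero L₂] [NeZero M₂], L ≤ L₁ → L₁ ∣ L₂ → (klEngQ7 P R).M0 β L₁ ≤ M₂ →
      Mq L₁ ≤ M₂ → (klEngQ7 P R).M0 β L₂ ≤ M₂ → Mq L₂ ≤ M₂ →
      (∀ j < n, histV17F2 L₁ M₂ klEngGeo7 P (klEngQ7 P R) R β U μ j ∧ TwoLegSlopes L₁ M₂ R β U μ (klFlowFrameU L₁ M₂ β U μ j) j) →
      (∀ j < n, histV17F2 L₂ M₂ klEngGeo7 P (klEngQ7 P R) R β U μ j ∧ TwoLegSlopes L₂ M₂ R β U μ (klFlowFrameU L₂ M₂ β U μ j) j) →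
        ∀ θ : ℝ, |klLocalPart L₁ M₂ β U μ (klFlowFrameU L₁ M₂ β U μ n) n θ -
          klLocalPart L₂ M₂ β U μ (klFlowFrameU L₂ M₂ β U μ n) n θ| ≤ (klEngQ7 P R).CL β n / 4 / L₁) :
    TwoLegStepV17F2 L M klEngGeo7 P (klEngQ7 P R) R β U μ n :=
  stub_twoLeg_step_of_engineSizes_GQ klEngGeo7 (klEngQ7 P R) P R c klC4aJetC_le_klEngGeo7_S (klC4aJetC'_le_klEngQ7_S' P R)
    (klEngQ7_CL_nonneg P R) (klEngC₃6_le_klEngC₃3 P R) (klEngU₀9_le_klEngU₀4 P R c) (klEngU₀9_le_klE3U₀all P R c) hP hR hc hc3 μ hμ U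
    hU hUle β hβ hβc L M hL hM n hn1 hn hreg hhist hfr hE hJ hZ hS hzZ hmS hcut hsp

/-- **STUB (M) OF 20437 FROM THE REV-1 TEXT, AT THE REGISTERED BYTES**: the stub's literal binders + `TwoLegStepV17F L M klEngGeo7 P (klEngQ7 P R) R β U μ 0`
⇒ `TwoLegStepV17F2 L M klEngGeo7 P (klEngQ7 P R) R β U μ 0` (the comparison histories are vacuous at `n = 0`). -/
theorem stub_twoLeg_scale0_of_twoLegStepV17F_zero_Q7U9 (P : SplitConsts) (R : RenConsts) (c : ℝ) (hP : P.WF) (hR : R.WF2) (hc : 0 < c)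
    (hc3 : c ≤ klEngC₃6 P R) (μ : ℝ) (hμ : μ ∈ klWindowC) (U : ℝ) (hU : 0 < U) (hUle : U ≤ klEngU₀9 P R c) (β : ℝ)
    (hβ : klBetaMin ≤ β) (hβc : β ≤ Real.exp (c / U ^ 2)) (L M : ℕ) [NeZero L] [NeZero M] (hL : klEngL₃ β U ≤ L)
    (hM : klEngM₃ β U L ≤ M) (hfr : FrameOK R U (nScales β) μ (klFlowFrameU L M β U μ 0))
    (hE : EngineBoundsAtV17F2 L M klEngGeo7 P (klEngQ7 P R) β U μ 0)
    (hJ : TwoLegReadJetBound L M klC4aJetC (klC4aJetC' P R) β U μ (klFlowFrameU L M β U μ 0) 0)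
    (h : TwoLegStepV17F L M klEngGeo7 P (klEngQ7 P R) R β U μ 0) :
    TwoLegStepV17F2 L M klEngGeo7 P (klEngQ7 P R) R β U μ 0 :=
  stub_twoLeg_scale0_of_twoLegStepV17F_zero_GQ klEngGeo7 (klEngQ7 P R) (c₃ := klEngC₃6 P R) (U₀c := klEngU₀9 P R c) P R c hP hR hc
    hc3 μ hμ U hU hUle β hβ hβc L M hL hM hfr hE hJ h

/-! ## §3 Residual B in grid-moment currency, at the registered bytes -/

/-- **STUB (e) OF 20437 WITH RESIDUAL B IN GRID-MOMENT CURRENCY, AT THE REGISTERED BYTES** `(klEngGeo7, klEngQ7 P R, klEngC₃6 P R, klEngU₀9 P R c)`: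
the stub's literal binders; then, with `K_n := klFlowFrameU L M β U μ n` and `W' := effAction (S_{4M}ᵀ C^{K_n}_{>Λ_n} S_{4M}) (V_{4M} + 𝒩_{K_n,4M}) − 𝒩_{K_n,4M}`,
`hBt` (circular temporal first moment of `kernel₂ W'` `≤ Bᵗ`), `hB1` (off-diagonal first space moment `≤ B₁`), the conversions `(2·4M/β)·Bᵗ ≤ Z·U²`,
`(2·4M/β)·B₁ ≤ S·U²`, the allowances `Z, S ≤ 2^{10|11}e¹⁸κ₀⁴·klE3Acum R`, and C1 `hcut`, C2 `hsp` ⇒ `TwoLegStepV17F2 L M klEngGeo7 P (klEngQ7 P R) R β U μ n`. -/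
theorem stub_twoLeg_step_of_gridMoments_Q7U9 (P : SplitConsts) (R : RenConsts) (c : ℝ) (hP : P.WF) (hR : R.WF2) (hc : 0 < c)
    (hc3 : c ≤ klEngC₃6 P R) (μ : ℝ) (hμ : μ ∈ klWindowC) (U : ℝ) (hU : 0 < U) (hUle : U ≤ klEngU₀9 P R c) (β : ℝ)
    (hβ : klBetaMin ≤ β) (hβc : β ≤ Real.exp (c / U ^ 2)) (L M : ℕ) [NeZero L] [NeZero M] (hL : klEngL₃ β U ≤ L)
    (hM : klEngM₃ β U L ≤ M) (n : ℕ) (hn1 : 1 ≤ n) (hn : n ≤ nScales β + 1) (hreg : IsKLRegime U c (-(n : ℤ)))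
    (hhist : HistP klPredsV17F2 L M klEngGeo7 P (klEngQ7 P R) R β U μ 0 n)
    (hfr : FrameOK R U (nScales β) μ (klFlowFrameU L M β U μ n))
    (hE : EngineBoundsAtV17F2 L M klEngGeo7 P (klEngQ7 P R) β U μ n)
    (hJ : TwoLegReadJetBound L M klC4aJetC (klC4aJetC' P R) β U μ (klFlowFrameU L M β U μ n) n)
    {Bt B₁ Z S : ℝ}
    (hBt : ∀ (σ : Fin 2) (p₀ : GridPoint L (2 * (2 * M))), ∑ p₁ : GridPoint L (2 * (2 * M)),
      β / ((2 * (2 * M) : ℕ) : ℝ) * (circDist (2 * (2 * M)) p₀.1.val p₁.1.val : ℝ) *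
        ‖kernel ℂ
          (effAction ℂ ((hubbardGridSub L M β (2 * (2 * M))).transpose *
              hubbardCovAboveCT L M β μ 0 (klFlowFrameU L M β U μ n) (klScale klE0 n) * hubbardGridSub L M β (2 * (2 * M)))
            (hubbardGridInteraction L (2 * (2 * M)) β U + hubbardGridCounterQuadratic L (2 * (2 * M)) β (klFlowFrameU L M β U μ n)) -
            hubbardGridCounterQuadratic L (2 * (2 * M)) β (klFlowFrameU L M β U μ n)) 2
          (fun i => ((![p₀, p₁] i, σ), i))‖ ≤ Bt)
    (hB1 : ∀ (σ : Fin 2) (p₀ : GridPoint L (2 * (2 * M))), ∑ p₁ : GridPoint L (2 * (2 * M)),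
      (if p₁.2 - p₀.2 = 0 then (0 : ℝ) else
        (1 + (((p₁.2 - p₀.2) 0).valMinAbs.natAbs : ℝ) + (((p₁.2 - p₀.2) 1).valMinAbs.natAbs : ℝ)) ^ 1) *
        ‖kernel ℂ
          (effAction ℂ ((hubbardGridSub L M β (2 * (2 * M))).transpose *
              hubbardCovAboveCT L M β μ 0 (klFlowFrameU L M β U μ n) (klScale klE0 n) * hubbardGridSub L M β (2 * (2 * M)))
            (hubbardGridInteraction L (2 * (2 * M)) β U + hubbardGridCounterQuadratic L (2 * (2 * M)) β (klFlowFrameU L M β U μ n)) -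
            hubbardGridCounterQuadratic L (2 * (2 * M)) β (klFlowFrameU L M β U μ n)) 2
          (fun i => ((![p₀, p₁] i, σ), i))‖ ≤ B₁)
    (hZ : 2 * ((2 * (2 * M) : ℕ) : ℝ) / β * Bt ≤ Z * U ^ 2) (hS : 2 * ((2 * (2 * M) : ℕ) : ℝ) / β * B₁ ≤ S * U ^ 2)
    (hZa : Z ≤ (2 : ℝ) ^ 10 * Real.exp 1 ^ 18 * Real.sqrt (2 * (7 + 1606732)) ^ 4 * klE3Acum R)
    (hSa : S ≤ (2 : ℝ) ^ 11 * Real.exp 1 ^ 18 * Real.sqrt (2 * (7 + 1606732)) ^ 4 * klE3Acum R)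
    (hcut : ∀ (Mq : ℕ → ℕ) (L₁ M₁ M₂ : ℕ) [NeZero L₁] [NeZero M₁] [NeZero M₂], L ≤ L₁ → (klEngQ7 P R).M0 β L₁ ≤ M₁ → Mq L₁ ≤ M₁ →
      M₁ ≤ M₂ →
      (∀ j < n, histV17F2 L₁ M₁ klEngGeo7 P (klEngQ7 P R) R β U μ j ∧ TwoLegSlopes L₁ M₁ R β U μ (klFlowFrameU L₁ M₁ β U μ j) j) →
      (∀ j < n, histV17F2 L₁ M₂ klEngGeo7 P (klEngQ7 P R) R β U μ j ∧ TwoLegSlopes L₁ M₂ R β U μ (klFlowFrameU L₁ M₂ β U μ j) j) →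
        ∀ θ : ℝ, |klLocalPart L₁ M₁ β U μ (klFlowFrameU L₁ M₁ β U μ n) n θ -
          klLocalPart L₁ M₂ β U μ (klFlowFrameU L₁ M₂ β U μ n) n θ| ≤ (klEngQ7 P R).CL β n / 4 / L₁)
    (hsp : ∀ (Mq : ℕ → ℕ) (L₁ L₂ M₂ : ℕ) [NeZero L₁] [NeZero L₂] [NeZero M₂], L ≤ L₁ → L₁ ∣ L₂ → (klEngQ7 P R).M0 β L₁ ≤ M₂ →
      Mq L₁ ≤ M₂ → (klEngQ7 P R).M0 β L₂ ≤ M₂ → Mq L₂ ≤ M₂ →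
      (∀ j < n, histV17F2 L₁ M₂ klEngGeo7 P (klEngQ7 P R) R β U μ j ∧ TwoLegSlopes L₁ M₂ R β U μ (klFlowFrameU L₁ M₂ β U μ j) j) →
      (∀ j < n, histV17F2 L₂ M₂ klEngGeo7 P (klEngQ7 P R) R β U μ j ∧ TwoLegSlopes L₂ M₂ R β U μ (klFlowFrameU L₂ M₂ β U μ j) j) →
        ∀ θ : ℝ, |klLocalPart L₁ M₂ β U μ (klFlowFrameU L₁ M₂ β U μ n) n θ -
          klLocalPart L₂ M₂ β U μ (klFlowFrameU L₂ M₂ β U μ n) n θ| ≤ (klEngQ7 P R).CL β n / 4 / L₁) :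
    TwoLegStepV17F2 L M klEngGeo7 P (klEngQ7 P R) R β U μ n :=
  stub_twoLeg_step_of_gridMoments_GQ klEngGeo7 (klEngQ7 P R) P R c klC4aJetC_le_klEngGeo7_S (klC4aJetC'_le_klEngQ7_S' P R)
    (klEngQ7_CL_nonneg P R) (klEngC₃6_le_klEngC₃3 P R) (klEngU₀9_le_klEngU₀4 P R c) (klEngU₀9_le_klE3U₀all P R c) hP hR hc hc3 μ hμ U
    hU hUle β hβ hβc L M hL hM n hn1 hn hreg hhist hfr hE hJ hBt hB1 hZ hS hZa hSa hcut hsp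

end Summit.HubbardSuperconductivity.HubbardSuperconductivity.Theorems.EngineV8

end
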